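import Literature.MathematicalPhysics.KineticTheory.HardSphereEulerLocalTheoryReduction
import Literature.MathematicalPhysics.KineticTheory.HardSphereEulerSolutionGluing
import Literature.Analysis.FluidPDE.CompressibleEulerJunction
import Literature.Analysis.FluidPDE.CompressibleEulerAprioriBounds
import HarnessLib

/-!
# The continuation principle for the hard-sphere Euler system from local existence

MathematicalPhysics/KineticTheory proof file (theorems only; no definitions, no named facts):
`hsEuler_continuation` (Dafermos 2005, Thm 5.1.1, maximality clause, rendered in restart form in
`HardSphereEulerLocalTheory.lean`) follows from `hsEuler_localExistence` (the existence clause of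
the same theorem) by Majda's argument (Majda 1984, Ch. 2 §2.1, proof of Thm 2.2):

1. **a-priori bounds** — the `C¹` bound `M` and the state box `M⁻¹ ≤ ρ, θ ≤ M`, `ρσ³ ≤ η₁`
   (compact, inside the hyperbolicity region `p_ρ > 0` for `η₁` below the threshold of
   `exists_hyperbolicityThreshold`) bound ALL spatial derivatives of the solution on
   `[0, T) × 𝕋³` (`IsClassicalEulerSolution.spatialWordBounds_of_C1`, file
   `CompressibleEulerAprioriBounds` — the symmetrised `H^m` energy estimates);
2. **junction** — hence the solution extends smoothly to `[0, T] × 𝕋³`, the local solution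
   issued (by `hsEuler_localExistence`) from its value at `t = T` has the same `∞`-jet at `T`,
   and the two glue to a classical solution on `[0, T₂)`, `T₂ > T`
   (`IsClassicalEulerSolution.exists_extension_of_spatialBounds`, file `CompressibleEulerJunction`);
3. the bridge between hard-sphere solutions and classical solutions for the smooth athermal law
   `p = ρθZ(ρσ³)`, `Z = hsCompressibility` on `[0, η₀/2]`
   (`isHardSphereEulerSolution_iff_isClassicalEulerSolution`, file
   `HardSphereEulerLocalTheoryReduction`), valid while the packing stays in `[0, η₀/2]`, which the
   choice of `η₁` and of the open set `U = {ρ < η_c/σ³}` in step 2 guarantee; the local solution of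
   step 2 is first restricted (`IsHardSphereEulerSolution.restrict`, file
   `HardSphereEulerSolutionGluing`) to a short interval on which its packing stays below `η₀/2`
   (tube lemma `IsSmoothSpaceTimeOn.eventually_norm_sub_lt`).

Main result: `hsEuler_continuation_of_hsEuler_localExistence`.

## References

* C. M. Dafermos, *Hyperbolic Conservation Laws in Continuum Physics*, 2nd ed., Springer 2005,
  Ch. V §5.1, Thm 5.1.1 (pp. 122–126). [Dafermos2005]
* A. Majda, *Compressible Fluid Flow and Systems of Conservation Laws in Several Space
  Variables*, Springer 1984, Ch. 2 §2.1, Thms 2.1–2.2. [Majda1984]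
-/

noncomputable section

open Set Filter
open _root_.Topology
open scoped ContDiff

namespace Literature.MathematicalPhysics.KineticTheory

open Literature.Analysis.FunctionSpaces
open Literature.Analysis.FluidPDE.CompressibleEuler (EulerEOS IsClassicalEulerSolution)

/-- **A hard-sphere solution with small initial packing keeps small packing for a short time**
(tube lemma on the compact torus). [folklore] -/
theorem IsHardSphereEulerSolution.exists_forall_packing_lt {σ T : ℝ} {ρ θ : ℝ → T3 → ℝ}
    {u : ℝ → T3 → V3} (h : IsHardSphereEulerSolution σ T ρ u θ) (hT : 0 < T) (hσ : 0 < σ)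
    {η η' : ℝ} (hηη' : η < η') (h0 : ∀ x, ρ 0 x * σ ^ 3 ≤ η) :
    ∃ T' : ℝ, 0 < T' ∧ T' ≤ T ∧ ∀ t ∈ Ico 0 T', ∀ x, ρ t x * σ ^ 3 < η' := by
  have hσ3 : 0 < σ ^ 3 := pow_pos hσ 3
  have h0mem : (0 : ℝ) ∈ Ico 0 T := ⟨le_rfl, hT⟩
  have hε : 0 < (η' - η) / σ ^ 3 := div_pos (by linarith) hσ3
  have hev := h.smooth_density.eventually_norm_sub_lt h0mem hε
  rw [eventually_nhdsWithin_iff, Metric.eventually_nhds_iff] at hev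
  obtain ⟨δ, hδ, hball⟩ := hev
  refine ⟨min T δ, lt_min hT hδ, min_le_left _ _, fun t ht x => ?_⟩
  have htT : t ∈ Ico 0 T := ⟨ht.1, lt_of_lt_of_le ht.2 (min_le_left _ _)⟩
  have htδ : dist t 0 < δ := by
    rw [Real.dist_eq, sub_zero, abs_of_nonneg ht.1]
    exact lt_of_lt_of_le ht.2 (min_le_right _ _)
  have h1 := hball htδ htT x
  rw [Real.norm_eq_abs] at h1
  have h2 : (ρ t x - ρ 0 x) * σ ^ 3 < η' - η := (lt_div_iff₀ hσ3).1 (abs_lt.1 h1).2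
  have h3 := h0 x
  linarith [h2, h3]

/-- **The continuation principle from local existence** (Dafermos 2005, Thm 5.1.1; Majda 1984,
Thm 2.2): `hsEuler_localExistence → hsEuler_continuation`. Given `η₀, F` let `Z` be the smooth
compressibility factor with `hsCompressibility = Z` on `[0, η₀/2]`
(`exists_contDiff_eqOn_hsCompressibility`), `η_c ≤ η₀/2` its hyperbolicity threshold
(`exists_hyperbolicityThreshold`) and `η_a` the threshold of `hsEuler_localExistence`; take
`η₁ = min (η_c/2) (η_a/2)`. For a solution with the stated bounds: it is a classical solution for
`ζ(r) = Z(rσ³)` (bridge); its state lies in the compact box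
`K = [M⁻¹, min M (η₁/σ³)] × [M⁻¹, M] ⊆ {ρ, θ > 0, (ρζ)' > 0}`; all its spatial derivatives are
bounded (`spatialWordBounds_of_C1`); local solutions restart from any smooth data with values in
`K` (by `hsEuler_localExistence`, restricted to a short interval of packing `< η₀/2` and bridged);
so it extends to `[0, T₂)`, `T₂ > T`, with state in `U = {ρ < η_c/σ³}`
(`exists_extension_of_spatialBounds`), and the extension is again a hard-sphere solution (bridge).
[cite: Dafermos2005, Thm 5.1.1] -/
theorem hsEuler_continuation_of_hsEuler_localExistence (hLE : hsEuler_localExistence) :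
    hsEuler_continuation := by
  intro η₀ hη₀ F hF hEqF
  obtain ⟨Z, hZ, hEq⟩ := exists_contDiff_eqOn_hsCompressibility hη₀ hF hEqF
  obtain ⟨ηc, hηc, hηc₀, hpos⟩ := exists_hyperbolicityThreshold (half_pos hη₀) hZ hEq
  obtain ⟨ηa, hηa, hLEa⟩ := hLE η₀ hη₀ F hF hEqF
  set η₁ : ℝ := min (ηc / 2) (ηa / 2) with hη₁
  have hη₁pos : 0 < η₁ := lt_min (half_pos hηc) (half_pos hηa)
  have hη₁c : η₁ ≤ ηc / 2 := min_le_left _ _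
  have hη₁a : η₁ ≤ ηa / 2 := min_le_right _ _
  refine ⟨η₁, hη₁pos, fun σ hσ T M hT hM ρ θ u hE hB => ?_⟩
  have hσ3 : 0 < σ ^ 3 := pow_pos hσ 3
  set ζ : ℝ → ℝ := fun r => Z (r * σ ^ 3) with hζdef
  have hζs : ContDiff ℝ ∞ ζ := hZ.comp (contDiff_id.mul contDiff_const)
  set f₀ : ℝ → ℝ := fun _ => 0 with hf₀
  -- the given solution as a classical solution for `ζ`
  have hpk : ∀ t ∈ Ico 0 T, ∀ y, ρ t y * σ ^ 3 ∈ Icc 0 (η₀ / 2) := fun t ht y =>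
    ⟨mul_nonneg (hE.density_pos t ht y).le hσ3.le,
      (hB t ht y).2.2.2.2.2.1.trans (hη₁c.trans ((half_le_self hηc.le).trans hηc₀))⟩
  have hsol : IsClassicalEulerSolution (EulerEOS.monatomicExcess ζ f₀) T ρ u θ :=
    (isHardSphereEulerSolution_iff_isClassicalEulerSolution f₀ hEq hpk).1 hE
  -- the compact state box
  set K : Set (ℝ × ℝ) := Icc M⁻¹ (min M (η₁ / σ ^ 3)) ×ˢ Icc M⁻¹ M with hKdef
  have hK : IsCompact K := isCompact_Icc.prod isCompact_Icc
  have hMi : 0 < M⁻¹ := inv_pos.2 hM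
  have hstate : ∀ t ∈ Ico 0 T, ∀ x, (ρ t x, θ t x) ∈ K := by
    intro t ht x
    obtain ⟨h1, h2, h3, h4, -, h6, -⟩ := hB t ht x
    exact ⟨⟨h1, le_min h2 ((le_div_iff₀ hσ3).2 h6)⟩, ⟨h3, h4⟩⟩
  have hKr : ∀ z ∈ K, 0 < z.1 ∧ z.1 < ηc / σ ^ 3 ∧ 0 < z.2 := by
    rintro ⟨r, s⟩ ⟨⟨hr1, hr2⟩, ⟨hs1, -⟩⟩
    refine ⟨hMi.trans_le hr1, ?_, hMi.trans_le hs1⟩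
    calc r ≤ η₁ / σ ^ 3 := hr2.trans (min_le_right _ _)
      _ < ηc / σ ^ 3 := div_lt_div_of_pos_right (by linarith) hσ3
  have hKpos : K ⊆ Ioi 0 ×ˢ Ioi 0 := fun z hz => ⟨(hKr z hz).1, (hKr z hz).2.2⟩
  have hKhyp : K ⊆ {z : ℝ × ℝ | 0 < z.1 ∧ 0 < z.2 ∧ 0 < deriv (fun s => s * ζ s) z.1} :=
    fun z hz => ⟨(hKr z hz).1, (hKr z hz).2.2,
      deriv_mul_comp_rescale_pos hZ hσ hpos z.1 ⟨(hKr z hz).1, (hKr z hz).2.1⟩⟩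
  -- `C¹` bounds and the a-priori bounds of all spatial derivatives
  have hC1 : ∀ t ∈ Ico 0 T, ∀ x, ‖u t x‖ ≤ M ∧ ∀ i, |Torus.partialDeriv i (ρ t) x| ≤ M ∧
      ‖Torus.partialDeriv i (u t) x‖ ≤ M ∧ |Torus.partialDeriv i (θ t) x| ≤ M := fun t ht x =>
    ⟨(hB t ht x).2.2.2.2.1, fun i => ⟨((hB t ht x).2.2.2.2.2.2 i).2.1,
      ((hB t ht x).2.2.2.2.2.2 i).1, ((hB t ht x).2.2.2.2.2.2 i).2.2⟩⟩
  have hbd := hsol.spatialWordBounds_of_C1 hζs hT hK hKhyp hstate hC1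
  -- the restart hypothesis
  have hLE' : ∀ (ρ₀ ϑ₀ : T3 → ℝ) (u₀ : T3 → V3), Torus.IsSmooth ρ₀ → Torus.IsSmooth ϑ₀ →
      Torus.IsSmooth u₀ → (∀ x, (ρ₀ x, ϑ₀ x) ∈ K) →
      ∃ T' : ℝ, 0 < T' ∧ ∃ (ρ' ϑ' : ℝ → T3 → ℝ) (u' : ℝ → T3 → V3),
        IsClassicalEulerSolution (EulerEOS.monatomicExcess ζ f₀) T' ρ' u' ϑ' ∧
          ρ' 0 = ρ₀ ∧ u' 0 = u₀ ∧ ϑ' 0 = ϑ₀ := by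
    intro ρ₀ ϑ₀ u₀ hρ₀ hϑ₀ hu₀ hK₀
    have hρpos : ∀ x, 0 < ρ₀ x := fun x => (hKr _ (hK₀ x)).1
    have hϑpos : ∀ x, 0 < ϑ₀ x := fun x => (hKr _ (hK₀ x)).2.2
    have hpk₀ : ∀ x, ρ₀ x * σ ^ 3 ≤ η₁ := fun x => by
      have := ((hK₀ x).1).2.trans (min_le_right _ _)
      exact (le_div_iff₀ hσ3).1 this
    obtain ⟨T', hT', ρ', θ', u', hhs, hρ0, hu0, hθ0⟩ := hLEa σ hσ ρ₀ ϑ₀ u₀ hρ₀ hϑ₀ hu₀ hρpos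
      hϑpos (fun x => (hpk₀ x).trans (hη₁a.trans (half_le_self hηa.le)))
    -- shrink the interval so that the packing stays below `η₀/2`
    have hlt : η₁ < η₀ / 2 := lt_of_le_of_lt hη₁c (lt_of_lt_of_le (half_lt_self hηc) hηc₀)
    have h0pk : ∀ x, ρ' 0 x * σ ^ 3 ≤ η₁ := fun x => by rw [hρ0]; exact hpk₀ x
    obtain ⟨T'', hT'', hT''T', hsmall⟩ := hhs.exists_forall_packing_lt hT' hσ hlt h0pk
    have hhs' := hhs.restrict hT''T'
    have hpk' : ∀ t ∈ Ico 0 T'', ∀ y, ρ' t y * σ ^ 3 ∈ Icc 0 (η₀ / 2) := fun t ht y =>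
      ⟨mul_nonneg (hhs'.density_pos t ht y).le hσ3.le, (hsmall t ht y).le⟩
    exact ⟨T'', hT'', ρ', θ', u',
      (isHardSphereEulerSolution_iff_isClassicalEulerSolution f₀ hEq hpk').1 hhs', hρ0, hu0, hθ0⟩
  -- the open neighbourhood of `K` in which the bridge still applies
  set U : Set (ℝ × ℝ) := {z | z.1 < ηc / σ ^ 3} with hUdef
  have hUo : IsOpen U := isOpen_lt continuous_fst continuous_const
  have hKU : K ⊆ U := fun z hz => (hKr z hz).2.1
  obtain ⟨T₂, hT₂, ρ₂, ϑ₂, u₂, hsol₂, hagree, hU₂⟩ :=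
    hsol.exists_extension_of_spatialBounds hζs hT hK hKpos hstate hbd hLE' hUo hKU
  have hpk₂ : ∀ t ∈ Ico 0 T₂, ∀ y, ρ₂ t y * σ ^ 3 ∈ Icc 0 (η₀ / 2) := fun t ht y =>
    ⟨mul_nonneg (hsol₂.density_pos t ht y).le hσ3.le, by
      have h1 : ρ₂ t y < ηc / σ ^ 3 := hU₂ t ht y
      have h2 : ρ₂ t y * σ ^ 3 < ηc := (lt_div_iff₀ hσ3).1 h1
      exact h2.le.trans hηc₀⟩
  exact ⟨T₂, hT₂, ρ₂, ϑ₂, u₂,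
    (isHardSphereEulerSolution_iff_isClassicalEulerSolution f₀ hEq hpk₂).2 hsol₂, hagree⟩

end Literature.MathematicalPhysics.KineticTheory

end
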